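import Mathlib
import HarnessLib
import Summits.HubbardSuperconductivity.HubbardSuperconductivity.Theorems.KLProgrammeSWaveCascadeClosedForm

/-!
# Route `KLProgramme` — row 0′ (child 1): FIRST AND SECOND DIFFERENCES of the repulsive cascade ACROSS TRANSFERS — the comparison values and their
# scale decrements at three neighbouring transfers, controlled by the differences of the net masses (E1 docket (5′)(s1) «FREEZING», regularity half)

Cell gate-hubbard-kl, seat hubbard-kl-k3c1-p1 (g20; child-1 lineage; technique «composed-map remainder propagation»).  Sequel to `…SWaveCascadeClosedForm` (p704335:
the cascade `U_{n+1} = U_n/(1 + W_n U_n)` in closed form `U_n = U_0/(1 + U_0·Σ_{j<n}W_j)` and the exact two-cascade identity `U_n − U'_n = U_n·U'_n·Σ_{j<n}(W'_j − W_j)`)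
and companion of `…SWaveCascadePinnedDomination` (row 13, the sup half of (T2)'s bump data).

Context (pen g25 (R390)(A)/(R391)(B); k3c2-p3 g16's brick (T2) `TorusFourierL2.plainFourLegLine_of_pairTransfer_superposition`): the plain-line brick pays a superposition
`Σ_n a_n·B_n` of pair-transfer BUMPS; besides `sup|G_n|` (row 13) its bump data ask SECOND DIFFERENCES of the symbol `G_n(q) = (U_q(n+1) − U_q(n))/a_n` along the lattice
directions at the dyadic rate (`h₀/h₁` of (T2)).  In the cascade idealisation the transfer `q` enters ONLY through the net masses `W_q(j)`, `j ≤ n`; THIS FILE propagates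
first and second differences of the masses through the composed Möbius maps (generic real analysis, three cascades `Ua, Ub, Uc` = transfers `q, q+h, q+2h` from the
same `U_0 ≥ 0` under the negative-mass floor; `A_m, B_m, C_m` the partial sums `Σ_{j<m}` of `Wb − Wa`, `Wc − Wb`, `Wc − Wa`; `Ū` any common bound of the values involved):

* §1 values: `|Ub_n − Ua_n| ≤ Ū²·|A_n|` (`sWaveFloor_sub_le_of_le`); the EXACT second-difference identity
  **`Uc_n − 2Ub_n + Ua_n = −Ub_n·Uc_n·(B_n − A_n) + Ua_n·Ub_n·Uc_n·A_n·C_n`** (`sWaveFloor_secondDiff_eq`) and `|Uc_n − 2Ub_n + Ua_n| ≤ Ū²·|B_n − A_n| + Ū³·|A_n|·|C_n|`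
  (`sWaveFloor_secondDiff_le`);
* §2 decrements `ΔU_n = U_{n+1} − U_n = −W_n·U_n·U_{n+1}`: the discrete product rules (`sub_mul_sub_prodRule`, `secondDiff_mul_prodRule`), the first difference
  `|ΔUb_n − ΔUa_n| ≤ Ū²·|Wb_n − Wa_n| + Ū³·|Wa_n|·(|A_n| + |A_{n+1}|)` (`sWaveFloor_decrement_sub_le`) and the second difference
  `|ΔUc_n − 2ΔUb_n + ΔUa_n| ≤ Ū²|δ²W_n| + 2Ū³|Wb_n − Wa_n|(|B_n| + |B_{n+1}|) + |Wa_n|·(Ū³(|B_n − A_n| + |B_{n+1} − A_{n+1}|) + Ū⁴(|A_n||C_n| + 2|A_n||B_{n+1}| + |A_{n+1}||C_{n+1}|))`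
  (`sWaveFloor_decrement_secondDiff_le`); packaged with uniform data `|A_m|,|B_m| ≤ σ`, `|C_m| ≤ 2σ`, `|B_m − A_m| ≤ σ₂` (`m = n, n+1`), `|Wa_n| ≤ w₀`, `|Wb_n − Wa_n| ≤ w₁`,
  `|Wc_n − 2Wb_n + Wa_n| ≤ w₂`: **`|δ²ΔU_n| ≤ Ū²·w₂ + 4Ū³·w₁·σ + 2Ū³·w₀·σ₂ + 6Ū⁴·w₀·σ²`** (`sWaveFloor_decrement_secondDiff_le'`) — with dyadic mass data
  `w₁ ≲ b·r_n`, `w₂, σ₂ ≲ b·r_n²`, `σ ≲ b·r_n` (`r_n = h·4^n`) every term is `O(Ū²·b·r_n²)`, the bump rate (T2) asks, and `Ū` may be taken `D·U_o` from row 13.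

What remains the E1 producer's ((5′)): NAME the (E2-F2) net masses and prove their first/second difference bounds across in-class transfers (the scale-`j` pp slice varies at
rate `Λ_j`); the transfer-FREQUENCY direction and (s3).  Everything is proved; no definitions; nothing about the model is asserted; nothing asserts (X).1, any open stub, K3
or superconductivity. [folklore]
-/

noncomputable section

namespace Summit.HubbardSuperconductivity.HubbardSuperconductivity.Theorems.SWaveCascade

set_option linter.dupNamespace false -- summit = problem name (single-conjunct summit), D-0017

open Finset

/-! ## §0 Algebra: orientation of difference sums, discrete product rules -/

/-- Orientation of a sum of differences: `Σ_{j<n}(f_j − g_j) = −Σ_{j<n}(g_j − f_j)`. [folklore] -/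
theorem sum_range_sub_swap (f g : ℕ → ℝ) (n : ℕ) : ∑ j ∈ range n, (f j - g j) = -∑ j ∈ range n, (g j - f j) := by
  rw [← sum_neg_distrib]; exact sum_congr rfl fun j _ => by ring

/-- The partial sums of differences are additive across three transfers: `Σ(f_c − f_a) = Σ(f_b − f_a) + Σ(f_c − f_b)`. [folklore] -/
theorem sum_range_sub_add_sub (fa fb fc : ℕ → ℝ) (n : ℕ) :
    ∑ j ∈ range n, (fc j - fa j) = ∑ j ∈ range n, (fb j - fa j) + ∑ j ∈ range n, (fc j - fb j) := by
  rw [← sum_add_distrib]; exact sum_congr rfl fun j _ => by ring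

/-- The discrete product rule: `a'b' − ab = (a' − a)·b' + a·(b' − b)`. [folklore] -/
theorem sub_mul_sub_prodRule (a a' b b' : ℝ) : a' * b' - a * b = (a' - a) * b' + a * (b' - b) := by ring

/-- The discrete second-order product rule: `a₂b₂ − 2a₁b₁ + a₀b₀ = (a₂ − 2a₁ + a₀)·b₂ + 2(a₁ − a₀)(b₂ − b₁) + a₀·(b₂ − 2b₁ + b₀)`. [folklore] -/
theorem secondDiff_mul_prodRule (a₀ a₁ a₂ b₀ b₁ b₂ : ℝ) :
    a₂ * b₂ - 2 * (a₁ * b₁) + a₀ * b₀ = (a₂ - 2 * a₁ + a₀) * b₂ + 2 * ((a₁ - a₀) * (b₂ - b₁)) + a₀ * (b₂ - 2 * b₁ + b₀) := by ring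

/-! ## §1 Values: first and second differences across transfers -/

section Scalar

variable {Ua Ub Uc Wa Wb Wc νa νb νc : ℕ → ℝ} {N : ℕ}

/-- **First difference across transfers.**  Two cascades from the same `U_0 ≥ 0` under the floor, `n ≤ N`, `Ua_n, Ub_n ≤ Ū`:
`|Ub_n − Ua_n| ≤ Ū²·|Σ_{j<n}(Wb_j − Wa_j)|`. [folklore] -/
theorem sWaveFloor_sub_le_of_le (ha : 0 ≤ Ua 0) (hb0 : Ub 0 = Ua 0)
    (hUa : ∀ n, Ua (n + 1) = Ua n / (1 + Wa n * Ua n)) (hWνa : ∀ n, -νa n ≤ Wa n) (hνa : ∀ n, 0 ≤ νa n)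
    (hsa : 16 * Ua 0 * ∑ j ∈ range N, νa j ≤ 1)
    (hUb : ∀ n, Ub (n + 1) = Ub n / (1 + Wb n * Ub n)) (hWνb : ∀ n, -νb n ≤ Wb n) (hνb : ∀ n, 0 ≤ νb n)
    (hsb : 16 * Ub 0 * ∑ j ∈ range N, νb j ≤ 1) {n : ℕ} (hn : n ≤ N) {Ū : ℝ} (han : Ua n ≤ Ū) (hbn : Ub n ≤ Ū) :
    |Ub n - Ua n| ≤ Ū ^ 2 * |∑ j ∈ range n, (Wb j - Wa j)| := by
  have hb : 0 ≤ Ub 0 := by rw [hb0]; exact ha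
  have hUan := (sWaveFloor_bounds ha hUa hWνa hνa hsa n hn).1
  have hUbn := (sWaveFloor_bounds hb hUb hWνb hνb hsb n hn).1
  have heq := sWaveFloor_sub_eq ha hb0 hUa hWνa hνa hsa hUb hWνb hνb hsb n hn
  rw [abs_sub_comm, heq, abs_mul, abs_mul, abs_of_nonneg hUan, abs_of_nonneg hUbn, sq]
  exact mul_le_mul_of_nonneg_right (mul_le_mul han hbn hUbn (hUan.trans han)) (abs_nonneg _)

/-- **The exact second-difference identity across three transfers.**  Three cascades from the same `U_0 ≥ 0` under the floor, `n ≤ N`; with `A = Σ_{j<n}(Wb − Wa)`,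
`B = Σ_{j<n}(Wc − Wb)`, `C = Σ_{j<n}(Wc − Wa)`:  `Uc_n − 2Ub_n + Ua_n = −Ub_n·Uc_n·(B − A) + Ua_n·Ub_n·Uc_n·(A·C)`. [folklore] -/
theorem sWaveFloor_secondDiff_eq (ha : 0 ≤ Ua 0) (hb0 : Ub 0 = Ua 0) (hc0 : Uc 0 = Ua 0)
    (hUa : ∀ n, Ua (n + 1) = Ua n / (1 + Wa n * Ua n)) (hWνa : ∀ n, -νa n ≤ Wa n) (hνa : ∀ n, 0 ≤ νa n)
    (hsa : 16 * Ua 0 * ∑ j ∈ range N, νa j ≤ 1)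
    (hUb : ∀ n, Ub (n + 1) = Ub n / (1 + Wb n * Ub n)) (hWνb : ∀ n, -νb n ≤ Wb n) (hνb : ∀ n, 0 ≤ νb n)
    (hsb : 16 * Ub 0 * ∑ j ∈ range N, νb j ≤ 1)
    (hUc : ∀ n, Uc (n + 1) = Uc n / (1 + Wc n * Uc n)) (hWνc : ∀ n, -νc n ≤ Wc n) (hνc : ∀ n, 0 ≤ νc n)
    (hsc : 16 * Uc 0 * ∑ j ∈ range N, νc j ≤ 1) {n : ℕ} (hn : n ≤ N) :
    Uc n - 2 * Ub n + Ua n =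
      -(Ub n * Uc n) * (∑ j ∈ range n, (Wc j - Wb j) - ∑ j ∈ range n, (Wb j - Wa j)) +
        Ua n * Ub n * Uc n * ((∑ j ∈ range n, (Wb j - Wa j)) * ∑ j ∈ range n, (Wc j - Wa j)) := by
  have hb : 0 ≤ Ub 0 := by rw [hb0]; exact ha
  have hcb0 : Uc 0 = Ub 0 := by rw [hc0, hb0]
  have h_ab := sWaveFloor_sub_eq ha hb0 hUa hWνa hνa hsa hUb hWνb hνb hsb n hn
  have h_ac := sWaveFloor_sub_eq ha hc0 hUa hWνa hνa hsa hUc hWνc hνc hsc n hn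
  have h_bc := sWaveFloor_sub_eq hb hcb0 hUb hWνb hνb hsb hUc hWνc hνc hsc n hn
  set A := ∑ j ∈ range n, (Wb j - Wa j) with hA
  set B := ∑ j ∈ range n, (Wc j - Wb j) with hB
  set C := ∑ j ∈ range n, (Wc j - Wa j) with hC
  linear_combination h_ab - h_bc + (Ub n * A) * h_ac

/-- **Second difference across transfers, bound.**  Under the hypotheses of `sWaveFloor_secondDiff_eq` with `Ua_n, Ub_n, Uc_n ≤ Ū`:
`|Uc_n − 2Ub_n + Ua_n| ≤ Ū²·|B − A| + Ū³·|A|·|C|`. [folklore] -/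
theorem sWaveFloor_secondDiff_le (ha : 0 ≤ Ua 0) (hb0 : Ub 0 = Ua 0) (hc0 : Uc 0 = Ua 0)
    (hUa : ∀ n, Ua (n + 1) = Ua n / (1 + Wa n * Ua n)) (hWνa : ∀ n, -νa n ≤ Wa n) (hνa : ∀ n, 0 ≤ νa n)
    (hsa : 16 * Ua 0 * ∑ j ∈ range N, νa j ≤ 1)
    (hUb : ∀ n, Ub (n + 1) = Ub n / (1 + Wb n * Ub n)) (hWνb : ∀ n, -νb n ≤ Wb n) (hνb : ∀ n, 0 ≤ νb n)
    (hsb : 16 * Ub 0 * ∑ j ∈ range N, νb j ≤ 1)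
    (hUc : ∀ n, Uc (n + 1) = Uc n / (1 + Wc n * Uc n)) (hWνc : ∀ n, -νc n ≤ Wc n) (hνc : ∀ n, 0 ≤ νc n)
    (hsc : 16 * Uc 0 * ∑ j ∈ range N, νc j ≤ 1) {n : ℕ} (hn : n ≤ N) {Ū : ℝ} (han : Ua n ≤ Ū) (hbn : Ub n ≤ Ū) (hcn : Uc n ≤ Ū) :
    |Uc n - 2 * Ub n + Ua n| ≤
      Ū ^ 2 * |∑ j ∈ range n, (Wc j - Wb j) - ∑ j ∈ range n, (Wb j - Wa j)| +
        Ū ^ 3 * (|∑ j ∈ range n, (Wb j - Wa j)| * |∑ j ∈ range n, (Wc j - Wa j)|) := by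
  have hb : 0 ≤ Ub 0 := by rw [hb0]; exact ha
  have hc : 0 ≤ Uc 0 := by rw [hc0]; exact ha
  have hUan := (sWaveFloor_bounds ha hUa hWνa hνa hsa n hn).1
  have hUbn := (sWaveFloor_bounds hb hUb hWνb hνb hsb n hn).1
  have hUcn := (sWaveFloor_bounds hc hUc hWνc hνc hsc n hn).1
  have hŪ : 0 ≤ Ū := hUan.trans han
  rw [sWaveFloor_secondDiff_eq ha hb0 hc0 hUa hWνa hνa hsa hUb hWνb hνb hsb hUc hWνc hνc hsc hn]
  set A := ∑ j ∈ range n, (Wb j - Wa j)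
  set B := ∑ j ∈ range n, (Wc j - Wb j)
  set C := ∑ j ∈ range n, (Wc j - Wa j)
  have h2 : Ub n * Uc n ≤ Ū ^ 2 := by rw [sq]; exact mul_le_mul hbn hcn hUcn hŪ
  have h3 : Ua n * Ub n * Uc n ≤ Ū ^ 3 := by
    calc Ua n * Ub n * Uc n = Ua n * (Ub n * Uc n) := by ring
      _ ≤ Ū * Ū ^ 2 := mul_le_mul han h2 (mul_nonneg hUbn hUcn) hŪ
      _ = Ū ^ 3 := by ring
  refine (abs_add_le _ _).trans (add_le_add ?_ ?_)
  · rw [abs_mul, abs_neg, abs_mul, abs_of_nonneg hUbn, abs_of_nonneg hUcn]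
    exact mul_le_mul_of_nonneg_right h2 (abs_nonneg _)
  · rw [abs_mul, abs_mul, abs_mul, abs_mul, abs_of_nonneg hUan, abs_of_nonneg hUbn, abs_of_nonneg hUcn]
    exact mul_le_mul_of_nonneg_right h3 (mul_nonneg (abs_nonneg _) (abs_nonneg _))

/-! ## §2 Decrements: first and second differences across transfers -/

/-- **First difference of the decrements across transfers.**  Two cascades from the same `U_0 ≥ 0` under the floor, `n < N`, values at `n, n+1` bounded by `Ū`:
`|(Ub_{n+1} − Ub_n) − (Ua_{n+1} − Ua_n)| ≤ Ū²·|Wb_n − Wa_n| + Ū³·|Wa_n|·(|A_n| + |A_{n+1}|)`, `A_m = Σ_{j<m}(Wb_j − Wa_j)`. [folklore] -/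
theorem sWaveFloor_decrement_sub_le (ha : 0 ≤ Ua 0) (hb0 : Ub 0 = Ua 0)
    (hUa : ∀ n, Ua (n + 1) = Ua n / (1 + Wa n * Ua n)) (hWνa : ∀ n, -νa n ≤ Wa n) (hνa : ∀ n, 0 ≤ νa n)
    (hsa : 16 * Ua 0 * ∑ j ∈ range N, νa j ≤ 1)
    (hUb : ∀ n, Ub (n + 1) = Ub n / (1 + Wb n * Ub n)) (hWνb : ∀ n, -νb n ≤ Wb n) (hνb : ∀ n, 0 ≤ νb n)
    (hsb : 16 * Ub 0 * ∑ j ∈ range N, νb j ≤ 1) {n : ℕ} (hn : n < N) {Ū : ℝ}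
    (han : Ua n ≤ Ū) (han1 : Ua (n + 1) ≤ Ū) (hbn : Ub n ≤ Ū) (hbn1 : Ub (n + 1) ≤ Ū) :
    |(Ub (n + 1) - Ub n) - (Ua (n + 1) - Ua n)| ≤
      Ū ^ 2 * |Wb n - Wa n| + Ū ^ 3 * (|Wa n| * (|∑ j ∈ range n, (Wb j - Wa j)| + |∑ j ∈ range (n + 1), (Wb j - Wa j)|)) := by
  have hb : 0 ≤ Ub 0 := by rw [hb0]; exact ha
  have hUan := (sWaveFloor_bounds ha hUa hWνa hνa hsa n hn.le).1
  have hUan1 := (sWaveFloor_bounds ha hUa hWνa hνa hsa (n + 1) (Nat.succ_le_of_lt hn)).1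
  have hUbn := (sWaveFloor_bounds hb hUb hWνb hνb hsb n hn.le).1
  have hUbn1 := (sWaveFloor_bounds hb hUb hWνb hνb hsb (n + 1) (Nat.succ_le_of_lt hn)).1
  have hŪ : 0 ≤ Ū := hUan.trans han
  have hΔa := sWaveFloor_succ_sub hUa (sWaveFloor_step ha hUa hWνa hνa hsa n hn).1
  have hΔb := sWaveFloor_succ_sub hUb (sWaveFloor_step hb hUb hWνb hνb hsb n hn).1
  -- the two value differences at `n` and `n+1`
  have hdn := sWaveFloor_sub_le_of_le ha hb0 hUa hWνa hνa hsa hUb hWνb hνb hsb hn.le han hbn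
  have hdn1 := sWaveFloor_sub_le_of_le ha hb0 hUa hWνa hνa hsa hUb hWνb hνb hsb (Nat.succ_le_of_lt hn) han1 hbn1
  set A := ∑ j ∈ range n, (Wb j - Wa j)
  set A' := ∑ j ∈ range (n + 1), (Wb j - Wa j)
  -- product rule: Wb·Pb − Wa·Pa = (Wb − Wa)·Pb + Wa·(Pb − Pa), Pb − Pa = (Ub_n − Ua_n)·Ub_{n+1} + Ua_n·(Ub_{n+1} − Ua_{n+1})
  have hid : (Ub (n + 1) - Ub n) - (Ua (n + 1) - Ua n) =
      -((Wb n - Wa n) * (Ub n * Ub (n + 1)) + Wa n * ((Ub n - Ua n) * Ub (n + 1) + Ua n * (Ub (n + 1) - Ua (n + 1)))) := by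
    rw [hΔa, hΔb]; ring
  rw [hid, abs_neg]
  have hPb : Ub n * Ub (n + 1) ≤ Ū ^ 2 := by rw [sq]; exact mul_le_mul hbn hbn1 hUbn1 hŪ
  have hP : |(Ub n - Ua n) * Ub (n + 1) + Ua n * (Ub (n + 1) - Ua (n + 1))| ≤ Ū ^ 3 * (|A| + |A'|) := by
    refine (abs_add_le _ _).trans ?_
    rw [abs_mul, abs_mul, abs_of_nonneg hUbn1, abs_of_nonneg hUan, mul_add]
    refine add_le_add ?_ ?_
    · calc |Ub n - Ua n| * Ub (n + 1) ≤ Ū ^ 2 * |A| * Ū := mul_le_mul hdn hbn1 hUbn1 (by positivity)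
        _ = Ū ^ 3 * |A| := by ring
    · calc Ua n * |Ub (n + 1) - Ua (n + 1)| ≤ Ū * (Ū ^ 2 * |A'|) := mul_le_mul han hdn1 (abs_nonneg _) hŪ
        _ = Ū ^ 3 * |A'| := by ring
  calc |(Wb n - Wa n) * (Ub n * Ub (n + 1)) + Wa n * ((Ub n - Ua n) * Ub (n + 1) + Ua n * (Ub (n + 1) - Ua (n + 1)))|
      ≤ |(Wb n - Wa n) * (Ub n * Ub (n + 1))| + |Wa n * ((Ub n - Ua n) * Ub (n + 1) + Ua n * (Ub (n + 1) - Ua (n + 1)))| :=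
        abs_add_le _ _
    _ ≤ Ū ^ 2 * |Wb n - Wa n| + Ū ^ 3 * (|Wa n| * (|A| + |A'|)) := by
        refine add_le_add ?_ ?_
        · rw [abs_mul, abs_mul, abs_of_nonneg hUbn, abs_of_nonneg hUbn1, mul_comm]
          exact mul_le_mul_of_nonneg_right hPb (abs_nonneg _)
        · rw [abs_mul]
          calc |Wa n| * |(Ub n - Ua n) * Ub (n + 1) + Ua n * (Ub (n + 1) - Ua (n + 1))|
              ≤ |Wa n| * (Ū ^ 3 * (|A| + |A'|)) := mul_le_mul_of_nonneg_left hP (abs_nonneg _)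
            _ = Ū ^ 3 * (|Wa n| * (|A| + |A'|)) := by ring

/-- **Second difference of the decrements across three transfers.**  Three cascades from the same `U_0 ≥ 0` under the floor, `n < N`, the six values at `n, n+1`
bounded by `Ū`; with `A_m, B_m, C_m` the partial sums `Σ_{j<m}` of `Wb − Wa`, `Wc − Wb`, `Wc − Wa`:
`|ΔUc_n − 2ΔUb_n + ΔUa_n| ≤ Ū²|Wc_n − 2Wb_n + Wa_n| + 2Ū³|Wb_n − Wa_n|(|B_n| + |B_{n+1}|)
 + |Wa_n|·(Ū³(|B_n − A_n| + |B_{n+1} − A_{n+1}|) + Ū⁴(|A_n||C_n| + 2|A_n||B_{n+1}| + |A_{n+1}||C_{n+1}|))`. [folklore] -/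
theorem sWaveFloor_decrement_secondDiff_le (ha : 0 ≤ Ua 0) (hb0 : Ub 0 = Ua 0) (hc0 : Uc 0 = Ua 0)
    (hUa : ∀ n, Ua (n + 1) = Ua n / (1 + Wa n * Ua n)) (hWνa : ∀ n, -νa n ≤ Wa n) (hνa : ∀ n, 0 ≤ νa n)
    (hsa : 16 * Ua 0 * ∑ j ∈ range N, νa j ≤ 1)
    (hUb : ∀ n, Ub (n + 1) = Ub n / (1 + Wb n * Ub n)) (hWνb : ∀ n, -νb n ≤ Wb n) (hνb : ∀ n, 0 ≤ νb n)
    (hsb : 16 * Ub 0 * ∑ j ∈ range N, νb j ≤ 1)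
    (hUc : ∀ n, Uc (n + 1) = Uc n / (1 + Wc n * Uc n)) (hWνc : ∀ n, -νc n ≤ Wc n) (hνc : ∀ n, 0 ≤ νc n)
    (hsc : 16 * Uc 0 * ∑ j ∈ range N, νc j ≤ 1) {n : ℕ} (hn : n < N) {Ū : ℝ}
    (han : Ua n ≤ Ū) (han1 : Ua (n + 1) ≤ Ū) (hbn : Ub n ≤ Ū) (hbn1 : Ub (n + 1) ≤ Ū) (hcn : Uc n ≤ Ū) (hcn1 : Uc (n + 1) ≤ Ū) :
    |(Uc (n + 1) - Uc n) - 2 * (Ub (n + 1) - Ub n) + (Ua (n + 1) - Ua n)| ≤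
      Ū ^ 2 * |Wc n - 2 * Wb n + Wa n| +
        2 * Ū ^ 3 * (|Wb n - Wa n| * (|∑ j ∈ range n, (Wc j - Wb j)| + |∑ j ∈ range (n + 1), (Wc j - Wb j)|)) +
        |Wa n| * (Ū ^ 3 * (|∑ j ∈ range n, (Wc j - Wb j) - ∑ j ∈ range n, (Wb j - Wa j)| +
              |∑ j ∈ range (n + 1), (Wc j - Wb j) - ∑ j ∈ range (n + 1), (Wb j - Wa j)|) +
          Ū ^ 4 * (|∑ j ∈ range n, (Wb j - Wa j)| * |∑ j ∈ range n, (Wc j - Wa j)| +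
            2 * (|∑ j ∈ range n, (Wb j - Wa j)| * |∑ j ∈ range (n + 1), (Wc j - Wb j)|) +
            |∑ j ∈ range (n + 1), (Wb j - Wa j)| * |∑ j ∈ range (n + 1), (Wc j - Wa j)|)) := by
  have hb : 0 ≤ Ub 0 := by rw [hb0]; exact ha
  have hc : 0 ≤ Uc 0 := by rw [hc0]; exact ha
  have hcb0 : Uc 0 = Ub 0 := by rw [hc0, hb0]
  have hn1 : n + 1 ≤ N := Nat.succ_le_of_lt hn
  have hUan := (sWaveFloor_bounds ha hUa hWνa hνa hsa n hn.le).1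
  have hUan1 := (sWaveFloor_bounds ha hUa hWνa hνa hsa (n + 1) hn1).1
  have hUbn := (sWaveFloor_bounds hb hUb hWνb hνb hsb n hn.le).1
  have hUbn1 := (sWaveFloor_bounds hb hUb hWνb hνb hsb (n + 1) hn1).1
  have hUcn := (sWaveFloor_bounds hc hUc hWνc hνc hsc n hn.le).1
  have hUcn1 := (sWaveFloor_bounds hc hUc hWνc hνc hsc (n + 1) hn1).1
  have hŪ : 0 ≤ Ū := hUan.trans han
  have hΔa := sWaveFloor_succ_sub hUa (sWaveFloor_step ha hUa hWνa hνa hsa n hn).1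
  have hΔb := sWaveFloor_succ_sub hUb (sWaveFloor_step hb hUb hWνb hνb hsb n hn).1
  have hΔc := sWaveFloor_succ_sub hUc (sWaveFloor_step hc hUc hWνc hνc hsc n hn).1
  -- value differences: first (a,b) at n; (b,c) at n+1; second at n and n+1
  have hab := sWaveFloor_sub_le_of_le ha hb0 hUa hWνa hνa hsa hUb hWνb hνb hsb hn.le han hbn
  have hbc1 := sWaveFloor_sub_le_of_le hb hcb0 hUb hWνb hνb hsb hUc hWνc hνc hsc hn1 hbn1 hcn1
  have h2n := sWaveFloor_secondDiff_le ha hb0 hc0 hUa hWνa hνa hsa hUb hWνb hνb hsb hUc hWνc hνc hsc hn.le han hbn hcn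
  have h2n1 := sWaveFloor_secondDiff_le ha hb0 hc0 hUa hWνa hνa hsa hUb hWνb hνb hsb hUc hWνc hνc hsc hn1 han1 hbn1 hcn1
  set A := ∑ j ∈ range n, (Wb j - Wa j)
  set A' := ∑ j ∈ range (n + 1), (Wb j - Wa j)
  set B := ∑ j ∈ range n, (Wc j - Wb j)
  set B' := ∑ j ∈ range (n + 1), (Wc j - Wb j)
  set C := ∑ j ∈ range n, (Wc j - Wa j)
  set C' := ∑ j ∈ range (n + 1), (Wc j - Wa j)
  -- products P = U_n·U_{n+1}
  set Pa := Ua n * Ua (n + 1) with hPa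
  set Pb := Ub n * Ub (n + 1) with hPb
  set Pc := Uc n * Uc (n + 1) with hPc
  have hPc2 : Pc ≤ Ū ^ 2 := by rw [sq]; exact mul_le_mul hcn hcn1 hUcn1 hŪ
  -- the second-order product rule for W·P
  have hid : (Uc (n + 1) - Uc n) - 2 * (Ub (n + 1) - Ub n) + (Ua (n + 1) - Ua n) =
      -((Wc n - 2 * Wb n + Wa n) * Pc + 2 * ((Wb n - Wa n) * (Pc - Pb)) + Wa n * (Pc - 2 * Pb + Pa)) := by
    rw [hΔa, hΔb, hΔc, hPa, hPb, hPc]; ring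
  -- first difference of the products (b,c): Pc − Pb = (Uc_n − Ub_n)·Uc_{n+1} + Ub_n·(Uc_{n+1} − Ub_{n+1})
  have hbc := sWaveFloor_sub_le_of_le hb hcb0 hUb hWνb hνb hsb hUc hWνc hνc hsc hn.le hbn hcn
  have hPcb : |Pc - Pb| ≤ Ū ^ 3 * (|B| + |B'|) := by
    have : Pc - Pb = (Uc n - Ub n) * Uc (n + 1) + Ub n * (Uc (n + 1) - Ub (n + 1)) := by rw [hPb, hPc]; ring
    rw [this]
    refine (abs_add_le _ _).trans ?_
    rw [abs_mul, abs_mul, abs_of_nonneg hUcn1, abs_of_nonneg hUbn, mul_add]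
    refine add_le_add ?_ ?_
    · calc |Uc n - Ub n| * Uc (n + 1) ≤ Ū ^ 2 * |B| * Ū := mul_le_mul hbc hcn1 hUcn1 (by positivity)
        _ = Ū ^ 3 * |B| := by ring
    · calc Ub n * |Uc (n + 1) - Ub (n + 1)| ≤ Ū * (Ū ^ 2 * |B'|) := mul_le_mul hbn hbc1 (abs_nonneg _) hŪ
        _ = Ū ^ 3 * |B'| := by ring
  -- second difference of the products: product rule with a = U_n, b = U_{n+1}
  have hP2 : |Pc - 2 * Pb + Pa| ≤
      Ū ^ 3 * (|B - A| + |B' - A'|) + Ū ^ 4 * (|A| * |C| + 2 * (|A| * |B'|) + |A'| * |C'|) := by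
    have : Pc - 2 * Pb + Pa = (Uc n - 2 * Ub n + Ua n) * Uc (n + 1) +
        2 * ((Ub n - Ua n) * (Uc (n + 1) - Ub (n + 1))) + Ua n * (Uc (n + 1) - 2 * Ub (n + 1) + Ua (n + 1)) := by
      rw [hPa, hPb, hPc]; ring
    rw [this]
    have t1 : |(Uc n - 2 * Ub n + Ua n) * Uc (n + 1)| ≤ Ū ^ 3 * |B - A| + Ū ^ 4 * (|A| * |C|) := by
      rw [abs_mul, abs_of_nonneg hUcn1]
      calc |Uc n - 2 * Ub n + Ua n| * Uc (n + 1) ≤ (Ū ^ 2 * |B - A| + Ū ^ 3 * (|A| * |C|)) * Ū :=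
            mul_le_mul h2n hcn1 hUcn1 (by positivity)
        _ = Ū ^ 3 * |B - A| + Ū ^ 4 * (|A| * |C|) := by ring
    have t2 : |2 * ((Ub n - Ua n) * (Uc (n + 1) - Ub (n + 1)))| ≤ Ū ^ 4 * (2 * (|A| * |B'|)) := by
      rw [abs_mul, abs_two, abs_mul]
      calc 2 * (|Ub n - Ua n| * |Uc (n + 1) - Ub (n + 1)|) ≤ 2 * (Ū ^ 2 * |A| * (Ū ^ 2 * |B'|)) :=
            mul_le_mul_of_nonneg_left (mul_le_mul hab hbc1 (abs_nonneg _) (by positivity)) (by norm_num)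
        _ = Ū ^ 4 * (2 * (|A| * |B'|)) := by ring
    have t3 : |Ua n * (Uc (n + 1) - 2 * Ub (n + 1) + Ua (n + 1))| ≤ Ū ^ 3 * |B' - A'| + Ū ^ 4 * (|A'| * |C'|) := by
      rw [abs_mul, abs_of_nonneg hUan]
      calc Ua n * |Uc (n + 1) - 2 * Ub (n + 1) + Ua (n + 1)| ≤ Ū * (Ū ^ 2 * |B' - A'| + Ū ^ 3 * (|A'| * |C'|)) :=
            mul_le_mul han h2n1 (abs_nonneg _) hŪ
        _ = Ū ^ 3 * |B' - A'| + Ū ^ 4 * (|A'| * |C'|) := by ring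
    calc |(Uc n - 2 * Ub n + Ua n) * Uc (n + 1) + 2 * ((Ub n - Ua n) * (Uc (n + 1) - Ub (n + 1))) +
          Ua n * (Uc (n + 1) - 2 * Ub (n + 1) + Ua (n + 1))|
        ≤ |(Uc n - 2 * Ub n + Ua n) * Uc (n + 1)| + |2 * ((Ub n - Ua n) * (Uc (n + 1) - Ub (n + 1)))| +
          |Ua n * (Uc (n + 1) - 2 * Ub (n + 1) + Ua (n + 1))| := abs_add_three _ _ _
      _ ≤ _ := by linarith
  rw [hid, abs_neg]
  calc |(Wc n - 2 * Wb n + Wa n) * Pc + 2 * ((Wb n - Wa n) * (Pc - Pb)) + Wa n * (Pc - 2 * Pb + Pa)|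
      ≤ |(Wc n - 2 * Wb n + Wa n) * Pc| + |2 * ((Wb n - Wa n) * (Pc - Pb))| + |Wa n * (Pc - 2 * Pb + Pa)| := abs_add_three _ _ _
    _ ≤ Ū ^ 2 * |Wc n - 2 * Wb n + Wa n| + 2 * Ū ^ 3 * (|Wb n - Wa n| * (|B| + |B'|)) +
        |Wa n| * (Ū ^ 3 * (|B - A| + |B' - A'|) + Ū ^ 4 * (|A| * |C| + 2 * (|A| * |B'|) + |A'| * |C'|)) := by
        refine add_le_add (add_le_add ?_ ?_) ?_
        · rw [abs_mul, abs_of_nonneg (mul_nonneg hUcn hUcn1 : 0 ≤ Pc), mul_comm]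
          exact mul_le_mul_of_nonneg_right hPc2 (abs_nonneg _)
        · rw [abs_mul, abs_two, abs_mul]
          calc 2 * (|Wb n - Wa n| * |Pc - Pb|) ≤ 2 * (|Wb n - Wa n| * (Ū ^ 3 * (|B| + |B'|))) :=
                mul_le_mul_of_nonneg_left (mul_le_mul_of_nonneg_left hPcb (abs_nonneg _)) (by norm_num)
            _ = 2 * Ū ^ 3 * (|Wb n - Wa n| * (|B| + |B'|)) := by ring
        · rw [abs_mul]
          exact mul_le_mul_of_nonneg_left hP2 (abs_nonneg _)

/-- **Second difference of the decrements, packaged.**  Under the hypotheses of `sWaveFloor_decrement_secondDiff_le` with uniform data: partial sums `|A_m|, |B_m| ≤ σ`,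
`|C_m| ≤ 2σ`, second differences of partial sums `|B_m − A_m| ≤ σ₂` (`m = n, n+1`), masses `|Wa_n| ≤ w₀`, `|Wb_n − Wa_n| ≤ w₁`, `|Wc_n − 2Wb_n + Wa_n| ≤ w₂`:
`|ΔUc_n − 2ΔUb_n + ΔUa_n| ≤ Ū²·w₂ + 4Ū³·w₁·σ + 2Ū³·w₀·σ₂ + 6Ū⁴·w₀·σ²`. [folklore] -/
theorem sWaveFloor_decrement_secondDiff_le' (ha : 0 ≤ Ua 0) (hb0 : Ub 0 = Ua 0) (hc0 : Uc 0 = Ua 0)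
    (hUa : ∀ n, Ua (n + 1) = Ua n / (1 + Wa n * Ua n)) (hWνa : ∀ n, -νa n ≤ Wa n) (hνa : ∀ n, 0 ≤ νa n)
    (hsa : 16 * Ua 0 * ∑ j ∈ range N, νa j ≤ 1)
    (hUb : ∀ n, Ub (n + 1) = Ub n / (1 + Wb n * Ub n)) (hWνb : ∀ n, -νb n ≤ Wb n) (hνb : ∀ n, 0 ≤ νb n)
    (hsb : 16 * Ub 0 * ∑ j ∈ range N, νb j ≤ 1)
    (hUc : ∀ n, Uc (n + 1) = Uc n / (1 + Wc n * Uc n)) (hWνc : ∀ n, -νc n ≤ Wc n) (hνc : ∀ n, 0 ≤ νc n)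
    (hsc : 16 * Uc 0 * ∑ j ∈ range N, νc j ≤ 1) {n : ℕ} (hn : n < N) {Ū : ℝ}
    (han : Ua n ≤ Ū) (han1 : Ua (n + 1) ≤ Ū) (hbn : Ub n ≤ Ū) (hbn1 : Ub (n + 1) ≤ Ū) (hcn : Uc n ≤ Ū) (hcn1 : Uc (n + 1) ≤ Ū)
    {σ σ₂ w₀ w₁ w₂ : ℝ}
    (hA : |∑ j ∈ range n, (Wb j - Wa j)| ≤ σ) (hA' : |∑ j ∈ range (n + 1), (Wb j - Wa j)| ≤ σ)
    (hB : |∑ j ∈ range n, (Wc j - Wb j)| ≤ σ) (hB' : |∑ j ∈ range (n + 1), (Wc j - Wb j)| ≤ σ)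
    (hC : |∑ j ∈ range n, (Wc j - Wa j)| ≤ 2 * σ) (hC' : |∑ j ∈ range (n + 1), (Wc j - Wa j)| ≤ 2 * σ)
    (hBA : |∑ j ∈ range n, (Wc j - Wb j) - ∑ j ∈ range n, (Wb j - Wa j)| ≤ σ₂)
    (hBA' : |∑ j ∈ range (n + 1), (Wc j - Wb j) - ∑ j ∈ range (n + 1), (Wb j - Wa j)| ≤ σ₂)
    (hw₀ : |Wa n| ≤ w₀) (hw₁ : |Wb n - Wa n| ≤ w₁) (hw₂ : |Wc n - 2 * Wb n + Wa n| ≤ w₂) :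
    |(Uc (n + 1) - Uc n) - 2 * (Ub (n + 1) - Ub n) + (Ua (n + 1) - Ua n)| ≤
      Ū ^ 2 * w₂ + 4 * Ū ^ 3 * w₁ * σ + 2 * Ū ^ 3 * w₀ * σ₂ + 6 * Ū ^ 4 * w₀ * σ ^ 2 := by
  have hUan := (sWaveFloor_bounds ha hUa hWνa hνa hsa n hn.le).1
  have hŪ : 0 ≤ Ū := hUan.trans han
  have h := sWaveFloor_decrement_secondDiff_le ha hb0 hc0 hUa hWνa hνa hsa hUb hWνb hνb hsb hUc hWνc hνc hsc hn han han1 hbn hbn1 hcn hcn1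
  refine h.trans ?_
  set A := ∑ j ∈ range n, (Wb j - Wa j)
  set A' := ∑ j ∈ range (n + 1), (Wb j - Wa j)
  set B := ∑ j ∈ range n, (Wc j - Wb j)
  set B' := ∑ j ∈ range (n + 1), (Wc j - Wb j)
  set C := ∑ j ∈ range n, (Wc j - Wa j)
  set C' := ∑ j ∈ range (n + 1), (Wc j - Wa j)
  have hσ : 0 ≤ σ := (abs_nonneg _).trans hA
  have hσ₂ : 0 ≤ σ₂ := (abs_nonneg _).trans hBA
  have hw₀0 : 0 ≤ w₀ := (abs_nonneg _).trans hw₀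
  have hw₁0 : 0 ≤ w₁ := (abs_nonneg _).trans hw₁
  have hŪ2 : 0 ≤ Ū ^ 2 := by positivity
  have hŪ3 : 0 ≤ Ū ^ 3 := by positivity
  have hŪ4 : 0 ≤ Ū ^ 4 := by positivity
  -- term by term
  have e1 : Ū ^ 2 * |Wc n - 2 * Wb n + Wa n| ≤ Ū ^ 2 * w₂ := mul_le_mul_of_nonneg_left hw₂ hŪ2
  have e2 : 2 * Ū ^ 3 * (|Wb n - Wa n| * (|B| + |B'|)) ≤ 4 * Ū ^ 3 * w₁ * σ := by
    have : |Wb n - Wa n| * (|B| + |B'|) ≤ w₁ * (2 * σ) :=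
      mul_le_mul hw₁ (by linarith) (add_nonneg (abs_nonneg _) (abs_nonneg _)) hw₁0
    nlinarith
  have e3 : |B - A| + |B' - A'| ≤ 2 * σ₂ := by linarith
  have e4 : |A| * |C| + 2 * (|A| * |B'|) + |A'| * |C'| ≤ 6 * σ ^ 2 := by
    have p1 : |A| * |C| ≤ σ * (2 * σ) := mul_le_mul hA hC (abs_nonneg _) hσ
    have p2 : |A| * |B'| ≤ σ * σ := mul_le_mul hA hB' (abs_nonneg _) hσ
    have p3 : |A'| * |C'| ≤ σ * (2 * σ) := mul_le_mul hA' hC' (abs_nonneg _) hσ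
    nlinarith
  have e5 : Ū ^ 3 * (|B - A| + |B' - A'|) + Ū ^ 4 * (|A| * |C| + 2 * (|A| * |B'|) + |A'| * |C'|) ≤
      Ū ^ 3 * (2 * σ₂) + Ū ^ 4 * (6 * σ ^ 2) :=
    add_le_add (mul_le_mul_of_nonneg_left e3 hŪ3) (mul_le_mul_of_nonneg_left e4 hŪ4)
  have e6 : |Wa n| * (Ū ^ 3 * (|B - A| + |B' - A'|) + Ū ^ 4 * (|A| * |C| + 2 * (|A| * |B'|) + |A'| * |C'|)) ≤
      w₀ * (Ū ^ 3 * (2 * σ₂) + Ū ^ 4 * (6 * σ ^ 2)) :=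
    mul_le_mul hw₀ e5 (by positivity) hw₀0
  calc Ū ^ 2 * |Wc n - 2 * Wb n + Wa n| + 2 * Ū ^ 3 * (|Wb n - Wa n| * (|B| + |B'|)) +
        |Wa n| * (Ū ^ 3 * (|B - A| + |B' - A'|) + Ū ^ 4 * (|A| * |C| + 2 * (|A| * |B'|) + |A'| * |C'|))
      ≤ Ū ^ 2 * w₂ + 4 * Ū ^ 3 * w₁ * σ + w₀ * (Ū ^ 3 * (2 * σ₂) + Ū ^ 4 * (6 * σ ^ 2)) := add_le_add (add_le_add e1 e2) e6
    _ = Ū ^ 2 * w₂ + 4 * Ū ^ 3 * w₁ * σ + 2 * Ū ^ 3 * w₀ * σ₂ + 6 * Ū ^ 4 * w₀ * σ ^ 2 := by ring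

end Scalar

end Summit.HubbardSuperconductivity.HubbardSuperconductivity.Theorems.SWaveCascade

end
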